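import Literature.NumberTheory.Sieve.Maynard2016Prop61Decomposition
import HarnessLib

/-!
# Maynard 2016, Proposition 9.2 for `𝒜 = ℤ` — DECOMPOSITION into its error part and its main part

Sources: J. Maynard, *Dense clusters of primes in subsets*, Compositio Math. 152 (2016) 1517–1554 =
arXiv:1405.2593 [Maynard2016DenseClusters], Proposition 9.2 with proof (pp. 20–23) and Lemma 9.3
(pp. 21, 23–24); K. Ford, B. Green, S. Konyagin, J. Maynard, T. Tao, *Long gaps between primes*,
JAMS 31 (2018) = arXiv:1412.5029v4 [FordGreenKonyaginMaynardTao2018], Theorem 6 (7.13) p. 21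
(«(7.13) follows from [Maynard, Prop. 9.2] in the case (a_L, B) = 1»).

The leaf `Maynard2016DenseClusters_prop92Z` of `Maynard2016Prop61Decomposition` is the estimate
`∑_{n ∈ 𝒜(X)} 1_𝒫(L_m(n)) w_n = (1 + O(log^{−1/10} X))·mainTermB + O(errTermB)` in the frame of
[FGKMT, Thm 6]. The printed proof (p. 21) has two halves which share nothing but the quadratic form

  `Q_m = ∑'_{d, e ∈ 𝒟'_k, d_m = e_m = 1} λ_d λ_e/φ_{L_m}(∏ᵢ [dᵢ, eᵢ])`     (`primeQF`, display (9.9)),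

where `𝒟'_k = {d ∈ 𝒟_k : (d_j, a_j b_m − a_m b_j) = 1 ∀ j ≠ m}` (display (9.7), `dkBoxP`),
`φ_L(q) = φ(|a_m| q)/φ(|a_m|)` (`totForm`) and `∑'` is the cross-coprimality restriction
`(dᵢeᵢ, dⱼeⱼ) = 1` (`i ≠ j`):

* **the error part** (`Maynard2016Prop92ErrorPart`): «there is no contribution from `λ_d` with
  `(d_j, a_j b_m − a_m b_j) ≠ 1`», «`#𝒫_{L,𝒜}(x;q,a) ≠ 0` iff `(L(a),q) = 1`, which occurs iff
  `d_m = e_m = 1`», the inner sums are `#𝒫_{L,𝒜}(x; q, a)` over the `φ_ω(W)` admissible classes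
  mod `q = W[d,e]`, and the errors `E_q^{(2)}` are controlled by Hypothesis 1 (2) (`HypothesisOneZ`)
  and Cauchy–Schwarz exactly as `E_q^{(1)}` in Prop. 9.1 (p. 19): in the frame,
  `|∑_{n} 1_𝒫(L_m(n)) w_n − φ_ω(W) #𝒫_{L_m}(X)/φ_{L_m}(W) · Q_m| ≤ K · errTermB`;
* **the main part** (`Maynard2016Prop92MainPart`): the change of variables `y^{(m)}` (9.10), the local
  factors `S_p^{(m)}` (9.12), Lemma 9.3 and Lemma 8.4 in the `k − 1` live variables give, in the frame,
  `φ_ω(W)/φ_{L_m}(W) · Q_m = (1 + O(log^{−1/10} X)) (φ(|a_m|)/|a_m|) (B/φ(B))^{k−1} 𝔖_B(𝓛) (log R)^{k+1} J_k`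
  (`mainCoeffB`, the main term of (7.13) divided by `#𝒫_{L_m}(X)`; «summing over the `φ_ω(W)`
  residue classes», p. 23, and `∏_{p ∣ a_m, p ∤ B}(p − 1)/p = φ(|a_m|)/|a_m|` for `(a_m, B) = 1`).

`maynard2016_prop92Z_of_parts` PROVES `ErrorPart → MainPart → Maynard2016DenseClusters_prop92Z`
(`mainTermB = mainCoeffB · #𝒫_{L_m}(X)`, `#𝒫 ≥ 0`, triangle inequality; `K = max K_E K_M`).
Both parts are stated over the shared quantifier block `FGKMT2018.Prop61Frame` and the pinned data
(`sieveWt`, `lamVar`, `dkBox`, `MaynardDense.F`, `IF`, `JF`), so each is an independently attackable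
leaf with a fixed typed target.

## References
* J. Maynard, *Dense clusters of primes in subsets*, Compositio Math. 152 (2016), Prop. 9.2,
  Lemma 9.3, displays (9.6)–(9.12) [Maynard2016DenseClusters].
* K. Ford, B. Green, S. Konyagin, J. Maynard, T. Tao, *Long gaps between primes*, JAMS 31 (2018),
  Theorem 6 (7.13) [FordGreenKonyaginMaynardTao2018].
-/

noncomputable section

open Finset Filter

namespace Literature.NumberTheory.Sieve

open FGKMT2018

namespace FGKMT2018

variable {k : ℕ}

/-- The cross determinant `a_j b_m − a_m b_j` of the forms `L_j`, `L_m` (non-zero for `j ≠ m` when `𝓛`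
is non-degenerate). [cite: Maynard2016DenseClusters, proof of Prop. 9.2 p. 21 («(d_j, a_j b_m − a_m b_j) ≠ 1»), display (9.7)] -/
def crossDet (L : Fin k → ℤ × ℤ) (m j : Fin k) : ℤ := (L j).1 * (L m).2 - (L m).1 * (L j).2

/-- The restricted support `{d ∈ 𝒟'_k(𝓛) : d_m = 1}` of the proof of Prop. 9.2:
`d ∈ 𝒟_k(𝓛)`, `d_m = 1` and `(d_j, a_j b_m − a_m b_j) = 1` for all `j ≠ m` (display (9.7):
`𝒟'_k = {d : μ²(d) = 1, (d_j, W'_j) = 1 ∀ j}`, `W'_j = ∏_{p ∣ W_j (a_j b_m − a_m b_j)} p`).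
[cite: Maynard2016DenseClusters, proof of Prop. 9.2 p. 21, display (9.7) and «iff d_m = e_m = 1»] -/
def dkBoxP (L : Fin k → ℤ × ℤ) (B : ℕ) (R : ℝ) (m : Fin k) : Finset (Fin k → ℕ) :=
  (dkBox L B R).filter fun d => d m = 1 ∧ ∀ j, j ≠ m → Nat.Coprime (d j) (crossDet L m j).natAbs

/-- **The quadratic form of the main term of Prop. 9.2** (display (9.9) without its prefactor
`#𝒫_{L,𝒜}(x)/φ_L(W)`): `Q_m = ∑'_{d, e ∈ 𝒟'_k, d_m = e_m = 1} λ_d λ_e/φ_L(∏ᵢ [dᵢ, eᵢ])`, the sum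
restricted to cross-coprime pairs `(dᵢeᵢ, dⱼeⱼ) = 1` (`i ≠ j`), with `φ_L(q) = φ(|a_m| q)/φ(|a_m|)`
(`totForm (L m)`). [cite: Maynard2016DenseClusters, proof of Prop. 9.2 p. 21, display (9.9)] -/
def primeQF (L : Fin k → ℤ × ℤ) (B : ℕ) (R : ℝ) (F : (Fin k → ℝ) → ℝ) (m : Fin k) : ℝ :=
  ∑ d ∈ dkBoxP L B R m, ∑ e ∈ dkBoxP L B R m,
    if ∀ i j, i ≠ j → (d i * e i).Coprime (d j * e j) then
      lamVar L B R F d * lamVar L B R F e / totForm (L m) (∏ i, Nat.lcm (d i) (e i))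
    else 0

/-- The main term of (7.13) per prime counted: `(φ(|a_m|)/|a_m|) (B/φ(B))^{k−1} 𝔖_B(𝓛) (log R)^{k+1} J`
(so that `mainTermB = mainCoeffB · #𝒫_{L_m}(X)`, `mainTermB_eq_mainCoeffB_mul`).
[cite: FordGreenKonyaginMaynardTao2018, Thm 6 (7.13) p. 21; Maynard2016DenseClusters, Prop. 9.2 (statement)] -/
def mainCoeffB (L : Fin k → ℤ × ℤ) (B : ℕ) (R J : ℝ) (m : Fin k) : ℝ :=
  (Nat.totient (L m).1.natAbs : ℝ) / (L m).1.natAbs * bOverPhi B ^ (k - 1) * singSeriesExcl L B *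
    Real.log R ^ (k + 1) * J

/-- `mainTermB = mainCoeffB · #𝒫_{L_m}(X)`. [cite: FordGreenKonyaginMaynardTao2018, Thm 6 (7.13) p. 21] -/
theorem mainTermB_eq_mainCoeffB_mul (L : Fin k → ℤ × ℤ) (B : ℕ) (X R J : ℝ) (m : Fin k) :
    mainTermB L B X R J m = mainCoeffB L B R J m * primeCountZ (L m) X := by
  unfold mainTermB mainCoeffB
  ring

end FGKMT2018

/-- **[Maynard2016DenseClusters, Prop. 9.2, the error part of the proof (p. 21)]** for `𝒜 = ℤ`, in the
frame of [FGKMT, Thm 6]: for every form `L_m` of the family with `(a_m, B) = 1`, `L_m(n) > R` on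
`𝒜(X)` and Hypothesis 1 (2) at `θ = 1/3` with constant `C_H`,
`|∑_{n ∈ 𝒜(X)} 1_𝒫(L_m(n)) w_n − φ_ω(W) (#𝒫_{L_m}(X)/φ_{L_m}(W)) Q_m| ≤ K (B/φ(B))^k 𝔖_B(𝓛) #𝒜(X) (log R)^{k−1} I_k`
(`Q_m = primeQF`). Printed: the support restriction to `𝒟'_k` with `d_m = e_m = 1` («since
`d_j < R < L(n)`»), the `φ_ω(W)` classes mod `q = W[d,e]` by CRT, `E_q^{(2)}` by Hypothesis 1 (2) and
Cauchy–Schwarz with `E_q^{(2)} ≪ #𝒜(x)/φ_L(q)`, `|λ_d| ≪ log^k x` (Lemma 8.5 (i)), giving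
`O(#𝒜(x) W^{−1} (log x)^{−2k²})`, which is `O(errTermB)` by `𝔖_B ≥ e^{−7k}` and Lemma 8.6.
[cite: Maynard2016DenseClusters, Prop. 9.2, proof p. 21 (displays (9.6)–(9.9)), Prop. 9.1 proof p. 19 (the treatment of E_q); FordGreenKonyaginMaynardTao2018, Thm 6 (7.13) p. 21] -/
def Maynard2016Prop92ErrorPart : Prop :=
  ∀ C_H : ℝ, 0 < C_H → ∃ (C : ℕ) (K : ℝ), 0 < K ∧ FGKMT2018.Prop61Frame C fun B k L X R =>
    ∀ i : Fin k, Nat.Coprime (L i).1.natAbs B → (∀ n ∈ dyadZ X, R < (formEval (L i) n : ℝ)) →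
      HypothesisOneZ ((1 : ℝ) / 3) B k X (L i) C_H →
      |∑ n ∈ (dyadZ X).filter (fun n => 0 < formEval (L i) n ∧ (formEval (L i) n).natAbs.Prime),
          sieveWt L B R (MaynardDense.F k) n -
        phiOmega L (wCut k B) * primeCountZ (L i) X / totForm (L i) (wCut k B) *
          FGKMT2018.primeQF L B R (MaynardDense.F k) i|
        ≤ K * errTermB L B X R (MaynardDense.IF k)

/-- **[Maynard2016DenseClusters, Prop. 9.2, the main part of the proof (pp. 21–23) with Lemma 9.3]**
for `𝒜 = ℤ`, in the frame of [FGKMT, Thm 6]: for every form `L_m` of the family with `(a_m, B) = 1`,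
`φ_ω(W)/φ_{L_m}(W) · Q_m = (1 + O(log^{−1/10} X)) (φ(|a_m|)/|a_m|) (B/φ(B))^{k−1} 𝔖_B(𝓛) (log R)^{k+1} J_k`
(`Q_m = primeQF`, right side `mainCoeffB`). Printed: the change of variables `y^{(m)}_r` (9.10), the
local factors `S_p^{(m)} ∈ {p−2, p−1, −1, 0}` (9.12), the count (9.15), Lemma 9.3
(`y^{(m)}_r = log R · φ(a_m WB) W^{k−1}B^{k−1} 𝔖_{WB}/(a_m φ(WB)^k) ∫ H dt_m`), Lemma 8.4 in the
`k − 1` live variables and Lemma 8.6, then the sum over the `φ_ω(W)` classes and `(W, B) = 1`.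
[cite: Maynard2016DenseClusters, Prop. 9.2, proof pp. 21–23 (displays (9.9)–(9.22)), Lemma 9.3 pp. 23–24; FordGreenKonyaginMaynardTao2018, Thm 6 (7.13) p. 21] -/
def Maynard2016Prop92MainPart : Prop :=
  ∃ (C : ℕ) (K : ℝ), 0 < K ∧ FGKMT2018.Prop61Frame C fun B k L X R =>
    ∀ i : Fin k, Nat.Coprime (L i).1.natAbs B →
      |phiOmega L (wCut k B) / totForm (L i) (wCut k B) * FGKMT2018.primeQF L B R (MaynardDense.F k) i -
          FGKMT2018.mainCoeffB L B R (MaynardDense.JF k) i|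
        ≤ K / Real.log X ^ ((1 : ℝ) / 10) * FGKMT2018.mainCoeffB L B R (MaynardDense.JF k) i

/-- **Proposition 9.2 for `𝒜 = ℤ` assembled from its two printed halves**:
`Maynard2016Prop92ErrorPart → Maynard2016Prop92MainPart → Maynard2016DenseClusters_prop92Z`
(`mainTermB = mainCoeffB · #𝒫`, `#𝒫 ≥ 0`; the two bounds force `errTermB ≥ 0`, `mainCoeffB ≥ 0`;
`K = max K_E K_M`).
[cite: Maynard2016DenseClusters, Prop. 9.2, proof pp. 21–23 («Thus, putting everything together», display (9.22)); FordGreenKonyaginMaynardTao2018, Thm 6 (7.13) p. 21] -/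
theorem maynard2016_prop92Z_of_parts (hE : Maynard2016Prop92ErrorPart)
    (hM : Maynard2016Prop92MainPart) : Maynard2016DenseClusters_prop92Z := by
  intro C_H hCH
  obtain ⟨C₁, K₁, hK₁, h1⟩ := hE C_H hCH
  obtain ⟨C₂, K₂, hK₂, h2⟩ := hM
  refine ⟨max C₁ C₂, max K₁ K₂, lt_of_lt_of_le hK₁ (le_max_left _ _), ?_⟩
  have h12 := h1.and h2
  unfold FGKMT2018.Prop61Frame at h12 ⊢
  filter_upwards [h12, eventually_ge_atTop 4] with x hx hx4 B hB hBx k L X R hCk hk hadm hnd hcoef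
    hX1 hX2 hR1 hR2 i hcop hRi hH
  obtain ⟨hxE, hxM⟩ := hx B hB hBx k L X R hCk hk hadm hnd hcoef hX1 hX2 hR1 hR2
  have eE := hxE i hcop hRi hH
  have eM := hxM i hcop
  have hx4' : (4 : ℝ) ≤ x := by exact_mod_cast hx4
  have hX2' : (2 : ℝ) ≤ X := by linarith
  have hlogX : 0 < Real.log X := Real.log_pos (by linarith)
  have hu : 0 < Real.log X ^ ((1 : ℝ) / 10) := Real.rpow_pos_of_pos hlogX _
  set S : ℝ := ∑ n ∈ (dyadZ X).filter (fun n => 0 < formEval (L i) n ∧ (formEval (L i) n).natAbs.Prime),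
      sieveWt L B R (MaynardDense.F k) n with hS
  set P : ℝ := (primeCountZ (L i) X : ℝ) with hP
  set c : ℝ := phiOmega L (wCut k B) with hc
  set t : ℝ := totForm (L i) (wCut k B) with ht
  set Q : ℝ := FGKMT2018.primeQF L B R (MaynardDense.F k) i with hQ
  set T : ℝ := FGKMT2018.mainCoeffB L B R (MaynardDense.JF k) i with hT
  set E : ℝ := errTermB L B X R (MaynardDense.IF k) with hEdef
  have hP0 : 0 ≤ P := by rw [hP]; exact Nat.cast_nonneg _
  -- the two bounds force the non-negativity of `errTermB` and `mainCoeffB`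
  have hE0 : 0 ≤ E := by
    by_contra hneg
    have : K₁ * E < 0 := mul_neg_of_pos_of_neg hK₁ (not_le.1 hneg)
    linarith [abs_nonneg (S - c * P / t * Q)]
  have hT0 : 0 ≤ T := by
    by_contra hneg
    have : K₂ / Real.log X ^ ((1 : ℝ) / 10) * T < 0 :=
      mul_neg_of_pos_of_neg (div_pos hK₂ hu) (not_le.1 hneg)
    linarith [abs_nonneg (c / t * Q - T)]
  have hMT : mainTermB L B X R (MaynardDense.JF k) i = T * P := by
    rw [hT, hP, FGKMT2018.mainTermB_eq_mainCoeffB_mul]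
  have hMT0 : 0 ≤ mainTermB L B X R (MaynardDense.JF k) i := by rw [hMT]; positivity
  -- the main part scaled by `#𝒫 ≥ 0`
  have h2' : |c * P / t * Q - T * P| ≤ K₂ / Real.log X ^ ((1 : ℝ) / 10) * (T * P) := by
    have : c * P / t * Q - T * P = P * (c / t * Q - T) := by ring
    rw [this, abs_mul, abs_of_nonneg hP0]
    calc P * |c / t * Q - T| ≤ P * (K₂ / Real.log X ^ ((1 : ℝ) / 10) * T) :=
          mul_le_mul_of_nonneg_left eM hP0
      _ = K₂ / Real.log X ^ ((1 : ℝ) / 10) * (T * P) := by ring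
  calc |S - mainTermB L B X R (MaynardDense.JF k) i|
      ≤ |S - c * P / t * Q| + |c * P / t * Q - mainTermB L B X R (MaynardDense.JF k) i| :=
        abs_sub_le _ _ _
    _ ≤ K₁ * E + K₂ / Real.log X ^ ((1 : ℝ) / 10) * mainTermB L B X R (MaynardDense.JF k) i := by
        rw [hMT]; exact add_le_add eE h2'
    _ ≤ max K₁ K₂ * E +
          max K₁ K₂ / Real.log X ^ ((1 : ℝ) / 10) * mainTermB L B X R (MaynardDense.JF k) i :=
        add_le_add (mul_le_mul_of_nonneg_right (le_max_left _ _) hE0)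
          (mul_le_mul_of_nonneg_right (div_le_div_of_nonneg_right (le_max_right _ _) hu.le) hMT0)
    _ = max K₁ K₂ / Real.log X ^ ((1 : ℝ) / 10) * mainTermB L B X R (MaynardDense.JF k) i +
          max K₁ K₂ * E := by ring

end Literature.NumberTheory.Sieve
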